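import Mathlib.Analysis.InnerProductSpace.Orthonormal
import HarnessLib

/-!
# Bombieri's inequality: Bessel's inequality for almost-orthogonal vectors

For vectors `x, y₁, …, yₙ` of an inner-product space,
`Σ_i |⟪x, y_i⟫|² ≤ ‖x‖² · max_i Σ_j |⟪y_i, y_j⟫|`
[E. Bombieri, *A note on the large sieve*, Acta Arith. 18 (1971) 401–404; stated as eq. (11) in §5 of
H. L. Montgomery, *The analytic principle of the large sieve*, Bull. AMS 84 (1978) p. 553 ("Combining Lemmas 3 and 4 we
obtain an inequality of Bombieri [10]"), held p0007; and as eq. (5.129), §5.9 of Cerone–Dragomir, *Mathematical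
Inequalities: A Perspective* (2010), held p0186].  For an orthonormal family the maximum is `1` and the statement is
Bessel's inequality; in general it is the "duality"/Schur-test form of the large sieve (Selberg), and the abstract
content of every "large sieve for an almost-orthogonal system of characters".

Proof (Montgomery's Lemmas 3 + 4, written out): with `a_i := ⟪y_i, x⟫` and `v := Σ_i a_i • y_i` one has
`⟪v, x⟫ = Σ_i |a_i|² =: S`, so `S ≤ ‖v‖‖x‖` (Cauchy–Schwarz), while the Schur test
`|a_i||a_j| ≤ (|a_i|² + |a_j|²)/2` and the symmetry `|⟪y_i,y_j⟫| = |⟪y_j,y_i⟫|` give `‖v‖² ≤ M·S`; hence `S² ≤ M S ‖x‖²`.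

We state the bound with an explicit row-sum majorant `M` (hypothesis `hM`) rather than a `Finset.sup'`, which is
the form in which it is used.  Namespace `Literature.Analysis.InnerProduct` (path-aligned).  THEOREMS ONLY.
WHAT THIS IS NOT: not the arithmetic large sieve (that needs the Gram estimate for additive characters, see
`Literature/Barriers/Parity/LargeSieveLevelHalf*.lean`); not the Boas–Bellman variant with `(Σ_{i≠j}|⟪y_i,y_j⟫|²)^{1/2}`.
-/

namespace Literature.Analysis.InnerProduct

open scoped InnerProductSpace ComplexConjugate
open Finset RCLike

variable {𝕜 E : Type*} [RCLike 𝕜] [SeminormedAddCommGroup E] [InnerProductSpace 𝕜 E]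

/-- **Schur test for a Gram form.**  If every row sum `Σ_j ‖⟪y_i, y_j⟫‖` is at most `M`, then
`‖Σ_i c_i • y_i‖² ≤ M · Σ_i ‖c_i‖²`.  (Montgomery 1978, Lemma 4 with `K_r = 1`: a Hermitian matrix with row sums
`≤ B` has operator norm `≤ B`.) [cite: Montgomery1978, §5 Lemma 4 and eq. (9), p. 553] -/
theorem norm_sq_sum_smul_le_of_gram_rowSum_le {ι : Type*} (s : Finset ι) (y : ι → E) (c : ι → 𝕜) {M : ℝ}
    (hM : ∀ i ∈ s, ∑ j ∈ s, ‖⟪y i, y j⟫_𝕜‖ ≤ M) :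
    ‖∑ i ∈ s, c i • y i‖ ^ 2 ≤ M * ∑ i ∈ s, ‖c i‖ ^ 2 := by
  set v : E := ∑ i ∈ s, c i • y i with hv
  -- `‖v‖² = re ⟪v, v⟫ = re Σ_i Σ_j conj(c_i) c_j ⟪y_i, y_j⟫`
  have hexp : ⟪v, v⟫_𝕜 = ∑ i ∈ s, ∑ j ∈ s, (conj (c i) * c j) * ⟪y i, y j⟫_𝕜 := by
    rw [hv, sum_inner]
    refine sum_congr rfl fun i _ => ?_
    rw [inner_sum]
    refine sum_congr rfl fun j _ => ?_
    rw [inner_smul_left, inner_smul_right]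
    ring
  have hre : ‖v‖ ^ 2 = re ⟪v, v⟫_𝕜 := (inner_self_eq_norm_sq (𝕜 := 𝕜) v).symm
  -- bound each term by `‖c_i‖ ‖c_j‖ ‖G_{ij}‖ ≤ (‖c_i‖² + ‖c_j‖²)/2 · ‖G_{ij}‖`
  have hterm : ∀ i j, re ((conj (c i) * c j) * ⟪y i, y j⟫_𝕜)
      ≤ (‖c i‖ ^ 2 + ‖c j‖ ^ 2) / 2 * ‖⟪y i, y j⟫_𝕜‖ := by
    intro i j
    calc re ((conj (c i) * c j) * ⟪y i, y j⟫_𝕜)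
        ≤ ‖(conj (c i) * c j) * ⟪y i, y j⟫_𝕜‖ := re_le_norm _
      _ = ‖c i‖ * ‖c j‖ * ‖⟪y i, y j⟫_𝕜‖ := by rw [norm_mul, norm_mul, norm_conj]
      _ ≤ (‖c i‖ ^ 2 + ‖c j‖ ^ 2) / 2 * ‖⟪y i, y j⟫_𝕜‖ := by
          apply mul_le_mul_of_nonneg_right _ (norm_nonneg _)
          nlinarith [sq_nonneg (‖c i‖ - ‖c j‖)]
  have hsum : re ⟪v, v⟫_𝕜 ≤ ∑ i ∈ s, ∑ j ∈ s, (‖c i‖ ^ 2 + ‖c j‖ ^ 2) / 2 * ‖⟪y i, y j⟫_𝕜‖ := by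
    rw [hexp, map_sum]
    refine sum_le_sum fun i _ => ?_
    rw [map_sum]
    exact sum_le_sum fun j _ => hterm i j
  -- split the symmetric double sum
  have hsplit : ∑ i ∈ s, ∑ j ∈ s, (‖c i‖ ^ 2 + ‖c j‖ ^ 2) / 2 * ‖⟪y i, y j⟫_𝕜‖
      = (∑ i ∈ s, ‖c i‖ ^ 2 * ∑ j ∈ s, ‖⟪y i, y j⟫_𝕜‖) / 2
        + (∑ j ∈ s, ‖c j‖ ^ 2 * ∑ i ∈ s, ‖⟪y i, y j⟫_𝕜‖) / 2 := by
    have h1 : ∑ i ∈ s, ∑ j ∈ s, (‖c i‖ ^ 2 + ‖c j‖ ^ 2) / 2 * ‖⟪y i, y j⟫_𝕜‖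
        = ∑ i ∈ s, ∑ j ∈ s, (‖c i‖ ^ 2 * ‖⟪y i, y j⟫_𝕜‖ / 2 + ‖c j‖ ^ 2 * ‖⟪y i, y j⟫_𝕜‖ / 2) := by
      refine sum_congr rfl fun i _ => sum_congr rfl fun j _ => ?_; ring
    rw [h1]
    simp only [sum_add_distrib]
    congr 1
    · rw [sum_div]
      refine sum_congr rfl fun i _ => ?_
      rw [mul_sum, sum_div]
    · rw [sum_comm, sum_div]
      refine sum_congr rfl fun j _ => ?_
      rw [mul_sum, sum_div]
  -- the second row sums use the symmetry `‖⟪y_i, y_j⟫‖ = ‖⟪y_j, y_i⟫‖`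
  have hrow1 : ∑ i ∈ s, ‖c i‖ ^ 2 * ∑ j ∈ s, ‖⟪y i, y j⟫_𝕜‖ ≤ M * ∑ i ∈ s, ‖c i‖ ^ 2 := by
    rw [mul_sum]
    refine sum_le_sum fun i hi => ?_
    rw [mul_comm M]
    exact mul_le_mul_of_nonneg_left (hM i hi) (sq_nonneg _)
  have hrow2 : ∑ j ∈ s, ‖c j‖ ^ 2 * ∑ i ∈ s, ‖⟪y i, y j⟫_𝕜‖ ≤ M * ∑ i ∈ s, ‖c i‖ ^ 2 := by
    rw [mul_sum]
    refine sum_le_sum fun j hj => ?_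
    rw [mul_comm M]
    refine mul_le_mul_of_nonneg_left ?_ (sq_nonneg _)
    calc ∑ i ∈ s, ‖⟪y i, y j⟫_𝕜‖ = ∑ i ∈ s, ‖⟪y j, y i⟫_𝕜‖ :=
          sum_congr rfl fun i _ => norm_inner_symm _ _
      _ ≤ M := hM j hj
  calc ‖v‖ ^ 2 = re ⟪v, v⟫_𝕜 := hre
    _ ≤ _ := hsum
    _ = _ := hsplit
    _ ≤ (M * ∑ i ∈ s, ‖c i‖ ^ 2) / 2 + (M * ∑ i ∈ s, ‖c i‖ ^ 2) / 2 := by gcongr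
    _ = M * ∑ i ∈ s, ‖c i‖ ^ 2 := by ring

/-- **Bombieri's inequality** (Bessel's inequality for an almost-orthogonal family): if every row sum
`Σ_{j} ‖⟪y_i, y_j⟫‖` of the Gram matrix is at most `M` (and `0 ≤ M`), then
`Σ_i ‖⟪y_i, x⟫‖² ≤ M · ‖x‖²`.  For an orthonormal family `M = 1` gives Bessel's inequality.
[cite: Montgomery1978, §5 eq. (11), p. 553; CeroneDragomir2010, §5.9 eq. (5.129); Bombieri1971, Thm] -/
theorem bombieri_inequality {ι : Type*} (s : Finset ι) (x : E) (y : ι → E) {M : ℝ} (hM0 : 0 ≤ M)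
    (hM : ∀ i ∈ s, ∑ j ∈ s, ‖⟪y i, y j⟫_𝕜‖ ≤ M) :
    ∑ i ∈ s, ‖⟪y i, x⟫_𝕜‖ ^ 2 ≤ M * ‖x‖ ^ 2 := by
  set a : ι → 𝕜 := fun i => ⟪y i, x⟫_𝕜 with ha
  set S : ℝ := ∑ i ∈ s, ‖a i‖ ^ 2 with hS
  set v : E := ∑ i ∈ s, a i • y i with hv
  have hS0 : 0 ≤ S := sum_nonneg fun i _ => sq_nonneg _
  -- `⟪v, x⟫ = S`
  have hvx : ⟪v, x⟫_𝕜 = (S : 𝕜) := by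
    rw [hv, sum_inner, hS]
    push_cast
    refine sum_congr rfl fun i _ => ?_
    rw [inner_smul_left, ha, RCLike.conj_mul]
  -- `S ≤ ‖v‖ ‖x‖`
  have hS_le : S ≤ ‖v‖ * ‖x‖ := by
    have h := norm_inner_le_norm (𝕜 := 𝕜) v x
    rwa [hvx, norm_ofReal, abs_of_nonneg hS0] at h
  -- `‖v‖² ≤ M S`
  have hv_le : ‖v‖ ^ 2 ≤ M * S := norm_sq_sum_smul_le_of_gram_rowSum_le s y a hM
  -- conclude: `S² ≤ ‖v‖²‖x‖² ≤ M S ‖x‖²`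
  have hS2 : S * S ≤ M * ‖x‖ ^ 2 * S := by
    calc S * S ≤ (‖v‖ * ‖x‖) * (‖v‖ * ‖x‖) := mul_self_le_mul_self hS0 hS_le
      _ = ‖v‖ ^ 2 * ‖x‖ ^ 2 := by ring
      _ ≤ (M * S) * ‖x‖ ^ 2 := mul_le_mul_of_nonneg_right hv_le (sq_nonneg _)
      _ = M * ‖x‖ ^ 2 * S := by ring
  rcases hS0.lt_or_eq with hpos | hzero
  · exact le_of_mul_le_mul_right (by linarith [hS2]) hpos
  · rw [← hzero]; positivity

/-- The same inequality with `x` in the left slot: `Σ_i ‖⟪x, y_i⟫‖² ≤ M ‖x‖²`.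
[cite: Montgomery1978, §5 eq. (11), p. 553] -/
theorem bombieri_inequality' {ι : Type*} (s : Finset ι) (x : E) (y : ι → E) {M : ℝ} (hM0 : 0 ≤ M)
    (hM : ∀ i ∈ s, ∑ j ∈ s, ‖⟪y i, y j⟫_𝕜‖ ≤ M) :
    ∑ i ∈ s, ‖⟪x, y i⟫_𝕜‖ ^ 2 ≤ M * ‖x‖ ^ 2 := by
  calc ∑ i ∈ s, ‖⟪x, y i⟫_𝕜‖ ^ 2 = ∑ i ∈ s, ‖⟪y i, x⟫_𝕜‖ ^ 2 :=
        sum_congr rfl fun i _ => by rw [norm_inner_symm]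
    _ ≤ M * ‖x‖ ^ 2 := bombieri_inequality s x y hM0 hM

/-- **Bessel's inequality recovered**: for an orthonormal family the row sums are `1`.
[cite: Montgomery1978, §5 (remark after Lemma 3: "if the φ_r are orthonormal then … B = 1 … gives Bessel's inequality"), p. 552] -/
theorem sum_norm_inner_sq_le_of_orthonormal {ι : Type*} [DecidableEq ι] (s : Finset ι) (x : E) (y : ι → E)
    (hy : Orthonormal 𝕜 y) : ∑ i ∈ s, ‖⟪y i, x⟫_𝕜‖ ^ 2 ≤ ‖x‖ ^ 2 := by
  have h := bombieri_inequality (𝕜 := 𝕜) s x y zero_le_one (M := 1) (fun i hi => ?_)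
  · simpa using h
  · rw [orthonormal_iff_ite] at hy
    calc ∑ j ∈ s, ‖⟪y i, y j⟫_𝕜‖ = ∑ j ∈ s, (if i = j then (1 : ℝ) else 0) :=
          sum_congr rfl fun j _ => by rw [hy i j]; split_ifs <;> simp
      _ ≤ 1 := le_of_eq (by rw [sum_ite_eq]; simp [hi])

end Literature.Analysis.InnerProduct
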